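import Literature.NumberTheory.Transcendental.PhilipponCriterionSetup
import Literature.NumberTheory.Transcendental.PhilipponCriterionDescend
import HarnessLib

/-!
# Philippon's criterion over Nesterenko's toolkit, XI: the closest point, the level `M` and a generator outside `𝔓_{N,r}` — proofs only

`Literature/NumberTheory/Transcendental/PhilipponCriterionLevel.lean` — proofs only (no new
definitions, nothing asserted). First half of the induction step of Philippon's proof of
Théorème 2.11 (Publ. Math. IHÉS 64 (1986), §3, proof of Lemme 2.14, pp. 42–43), for a prime `𝔓`
satisfying the assertion `(A_r)` at level `N` (`Setup.Good`, `PhilipponCriterionSetup.lean`) with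
rank exactly `r ≥ 2`:

* `exists_close_zero` — the closest-point step ("on déduit du lemme (2.7) et de l'inégalité
  `(ii)_N` que `min Dist_{d_N}(y, θ) ≤ …`"): by Prop. 4.13 and `(ii)_N`, `V(𝔓)` has a point `β̄` with
  `‖ω̄ − β̄‖ ≤ exp(−Λ_r(N) size_N(𝔓)/(2 r deg 𝔓))`, hence `ρ_ω̄(𝔓) ≤ exp(−Λ_r(N) τ(N)/(2r))`;
* `exists_level` — the level `M` ("on définit alors `M` comme étant l'entier `≥ N₀` … le plus grand
  tel que d'une part `M ≤ N` et d'autre part `exp(−R(M)) > min ‖y − θ‖`"): the largest `M ∈ [N₀, N]`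
  with `ρ < κ e^{−R(M)}`, `κ = 1/(4Θ²)`; then `V(𝔓)` has an affine point `(1 : z)` with
  `max |z_i − θ_i| < e^{−R(M)}`, and `κ e^{−R(M+1)} ≤ ρ` if `M < N`;
* `exists_level_generator` — hence ("il existe un des générateurs de `I_M`, soit `Q`, tel que
  `ʰQ ∉ 𝔓_{N,r}`") a generator `E M i ∉ 𝔓` (`exists_not_mem_of_finite_zeros`,
  `PhilipponCriterionDescend.lean`).

## References

* [Philippon1986Criteres] P. Philippon, Publ. Math. IHÉS 64 (1986), §3, pp. 42–43.
* [NesterenkoPhilippon2001] LNM 1752 (2001), Ch. 3 Prop. 4.13 (p. 41).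
-/

noncomputable section

open MvPolynomial Real
open Literature.NumberTheory.Transcendental.Nesterenko

attribute [local instance] MvPolynomial.gradedAlgebra

namespace Literature.NumberTheory.Transcendental

namespace PhilipponMain

namespace Setup

variable (𝒮 : Setup)

/-! ### The closest point -/

/-- **The closest-point step** (Philippon 1986 p. 42, via LNM 1752 Ch. 3 Prop. 4.13): if a
homogeneous prime `𝔓` of rank `r` (`1 ≤ r ≤ m`) has `|𝔓(ω̄)| ≤ exp(−Λ · size_N(𝔓))` with
`Λ ≥ 2 + 8 r m³`, then some `β̄ ∈ V(𝔓)` has `‖ω̄ − β̄‖ ≤ exp(−Λ size_N(𝔓)/(2 r deg 𝔓))`.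
[cite: Philippon1986Criteres, §3 p. 42 (proof of Lemme 2.14)]
[cite: NesterenkoPhilippon2001, Ch. 3 Prop. 4.13 (p. 41)] -/
theorem exists_close_zero (h44 : NesterenkoPhilippon2001_ch3_prop_4_4)
    (h413 : NesterenkoPhilippon2001_ch3_prop_4_13) {r : ℕ} (hr1 : 1 ≤ r) (hrm : r ≤ 𝒮.m)
    {𝔓 : Ideal (Rx 𝒮.m)} (h𝔓 : 𝔓.IsPrime)
    (h𝔓hom : 𝔓.IsHomogeneous (homogeneousSubmodule (Fin (𝒮.m + 1)) ℚ)) (h𝔓unm : IsUnmixedOfRank 𝔓 r)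
    (N : ℕ) {Λ : ℝ} (hΛ : 2 + 8 * r * (𝒮.m : ℝ) ^ 3 ≤ Λ)
    (hsmall : iabs 𝔓 r 𝒮.ω ≤ exp (-(Λ * 𝒮.size N 𝔓 r))) :
    ∃ β ∈ projZeros 𝔓, projDist 𝒮.ω β ≤ exp (-(Λ * 𝒮.size N 𝔓 r / (2 * r * ideg 𝔓 r))) := by
  obtain ⟨β, hβ, hdist⟩ := h413 𝒮.m r 𝔓 hr1 hrm h𝔓hom h𝔓unm 𝒮.ω 𝒮.ω_ne_zero
  refine ⟨β, hβ, ?_⟩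
  have hdeg1 : 1 ≤ ideg 𝔓 r :=
    Literature.Barriers.Schanuel.one_le_ideg_of_isPrime h44 hr1 hrm h𝔓 h𝔓hom h𝔓unm
  set D : ℝ := (ideg 𝔓 r : ℝ) with hD
  set h : ℝ := iheight 𝔓 r with hh
  set s : ℝ := 𝒮.size N 𝔓 r with hs
  have hD1 : (1 : ℝ) ≤ D := by rw [hD]; exact_mod_cast hdeg1
  have hD0 : (0 : ℝ) < D := by linarith
  have hr0 : (0 : ℝ) < r := by exact_mod_cast hr1
  have hh0 : 0 ≤ h := height_nonneg _
  have hm0 : (0 : ℝ) ≤ 𝒮.m := Nat.cast_nonneg _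
  -- `h ≤ s` and `D ≤ s` (as `δ, τ ≥ 1`)
  have hhs : h ≤ s := by
    have h1 : h ≤ 𝒮.δ N * h := le_mul_of_one_le_left hh0 (𝒮.one_le_δ N)
    exact h1.trans (𝒮.δ_mul_iheight_le_size N 𝔓 r)
  have hDs : D ≤ s := by
    have h1 : D ≤ 𝒮.τ N * D := le_mul_of_one_le_left hD0.le (𝒮.one_le_τ N)
    exact h1.trans (𝒮.τ_mul_ideg_le_size N 𝔓 r)
  have hs0 : 0 < s := lt_of_lt_of_le hD0 hDs
  have hΛ2 : 2 ≤ Λ := by nlinarith [mul_nonneg hr0.le (pow_nonneg hm0 3)]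
  -- the right-hand side of Prop. 4.13 is at most `exp(−Λ s/(2r))`
  have hX : (iabs 𝔓 r 𝒮.ω * exp h) ^ (1 / (r : ℝ)) * exp (4 * (𝒮.m : ℝ) ^ 3 * D) ≤
      exp (-(Λ * s / (2 * r))) := by
    have h1 : iabs 𝔓 r 𝒮.ω * exp h ≤ exp (-(Λ * s) + h) := by
      rw [exp_add]; exact mul_le_mul_of_nonneg_right hsmall (exp_pos _).le
    have h2 : (iabs 𝔓 r 𝒮.ω * exp h) ^ (1 / (r : ℝ)) ≤ exp (-(Λ * s) + h) ^ (1 / (r : ℝ)) :=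
      rpow_le_rpow (mul_nonneg (iabs_nonneg _ _ _) (exp_pos _).le) h1 (by positivity)
    have h3 : exp (-(Λ * s) + h) ^ (1 / (r : ℝ)) = exp ((-(Λ * s) + h) / r) := by
      rw [← exp_mul]; ring_nf
    rw [h3] at h2
    calc (iabs 𝔓 r 𝒮.ω * exp h) ^ (1 / (r : ℝ)) * exp (4 * (𝒮.m : ℝ) ^ 3 * D)
        ≤ exp ((-(Λ * s) + h) / r) * exp (4 * (𝒮.m : ℝ) ^ 3 * D) :=
          mul_le_mul_of_nonneg_right h2 (exp_pos _).le
      _ = exp ((-(Λ * s) + h) / r + 4 * (𝒮.m : ℝ) ^ 3 * D) := by rw [exp_add]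
      _ ≤ exp (-(Λ * s / (2 * r))) := by
          rw [exp_le_exp]
          -- `(−Λ s + h)/r + 4 m³ D ≤ −Λ s/(2r)` iff `Λ s/2 ≥ h + 4 r m³ D`, true as `h, D ≤ s`, `Λ ≥ 2 + 8 r m³`
          rw [div_add' _ _ _ hr0.ne', div_le_iff₀ hr0]
          have e1 : -(Λ * s / (2 * r)) * r = -(Λ * s / 2) := by field_simp
          rw [e1]
          have e2 : 4 * (𝒮.m : ℝ) ^ 3 * D * r ≤ 4 * r * (𝒮.m : ℝ) ^ 3 * s := by
            have := mul_le_mul_of_nonneg_left hDs (show 0 ≤ 4 * r * (𝒮.m : ℝ) ^ 3 by positivity)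
            nlinarith
          nlinarith [mul_le_mul_of_nonneg_right hΛ hs0.le]
  have hpow : projDist 𝒮.ω β ^ ideg 𝔓 r ≤ exp (-(Λ * s / (2 * r))) := hdist.trans hX
  -- take `deg`-th roots
  have hgoal : exp (-(Λ * s / (2 * r * D))) ^ ideg 𝔓 r = exp (-(Λ * s / (2 * r))) := by
    rw [← exp_nat_mul, ← hD]
    congr 1
    field_simp
  rw [← hgoal] at hpow
  exact le_of_pow_le_pow_left₀ (by omega) (exp_pos _).le hpow

/-- Hence `ρ_ω̄(𝔓) ≤ exp(−Λ τ(N)/(2r))` and `V(𝔓) ≠ ∅`. [cite: Philippon1986Criteres, §3 p. 43] -/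
theorem rho_le_of_small (h44 : NesterenkoPhilippon2001_ch3_prop_4_4)
    (h413 : NesterenkoPhilippon2001_ch3_prop_4_13) {r : ℕ} (hr1 : 1 ≤ r) (hrm : r ≤ 𝒮.m)
    {𝔓 : Ideal (Rx 𝒮.m)} (h𝔓 : 𝔓.IsPrime)
    (h𝔓hom : 𝔓.IsHomogeneous (homogeneousSubmodule (Fin (𝒮.m + 1)) ℚ)) (h𝔓unm : IsUnmixedOfRank 𝔓 r)
    (N : ℕ) {Λ : ℝ} (hΛ : 2 + 8 * r * (𝒮.m : ℝ) ^ 3 ≤ Λ)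
    (hsmall : iabs 𝔓 r 𝒮.ω ≤ exp (-(Λ * 𝒮.size N 𝔓 r))) :
    (projZeros 𝔓).Nonempty ∧ rho 𝒮.ω 𝔓 ≤ exp (-(Λ * 𝒮.τ N / (2 * r))) := by
  obtain ⟨β, hβ, hd⟩ := 𝒮.exists_close_zero h44 h413 hr1 hrm h𝔓 h𝔓hom h𝔓unm N hΛ hsmall
  refine ⟨⟨β, hβ⟩, (rho_le_projDist 𝒮.ω hβ).trans (hd.trans ?_)⟩
  rw [exp_le_exp, neg_le_neg_iff]
  have hdeg1 : 1 ≤ ideg 𝔓 r :=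
    Literature.Barriers.Schanuel.one_le_ideg_of_isPrime h44 hr1 hrm h𝔓 h𝔓hom h𝔓unm
  have hD0 : (0 : ℝ) < ideg 𝔓 r := by exact_mod_cast hdeg1
  have hr0 : (0 : ℝ) < r := by exact_mod_cast hr1
  have hm0 : (0 : ℝ) ≤ 𝒮.m := Nat.cast_nonneg _
  have hΛ0 : 0 ≤ Λ := by nlinarith [mul_nonneg hr0.le (pow_nonneg hm0 3)]
  -- `Λ τ/(2r) ≤ Λ size/(2 r deg)` since `τ deg ≤ size`
  rw [div_le_div_iff₀ (by positivity) (by positivity)]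
  have h1 : 𝒮.τ N * ideg 𝔓 r ≤ 𝒮.size N 𝔓 r := 𝒮.τ_mul_ideg_le_size N 𝔓 r
  have h2 : Λ * 𝒮.τ N * (2 * r * ideg 𝔓 r) = (Λ * (𝒮.τ N * ideg 𝔓 r)) * (2 * r) := by ring
  rw [h2]
  exact mul_le_mul_of_nonneg_right (mul_le_mul_of_nonneg_left h1 hΛ0) (by positivity)

/-! ### The level `M` -/

/-- **The level `M`** (Philippon 1986 p. 43): if `ρ = ρ_ω̄(𝔓) < κ e^{−R(N₀)}` and `N₀ ≤ N`, the
largest `M ∈ [N₀, N]` with `ρ < κ e^{−R(M)}` exists; maximality gives `κ e^{−R(M+1)} ≤ ρ` when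
`M < N`. [cite: Philippon1986Criteres, §3 p. 43 (definition of M)] -/
theorem exists_level {ρ : ℝ} {N : ℕ} (hN : 𝒮.N₀ ≤ N) (hρ : ρ < 𝒮.κ * exp (-𝒮.R 𝒮.N₀)) :
    ∃ M : ℕ, 𝒮.N₀ ≤ M ∧ M ≤ N ∧ ρ < 𝒮.κ * exp (-𝒮.R M) ∧
      (M < N → 𝒮.κ * exp (-𝒮.R (M + 1)) ≤ ρ) := by
  classical
  set P : ℕ → Prop := fun M => ρ < 𝒮.κ * exp (-𝒮.R M) with hP
  refine ⟨Nat.findGreatest P N, ?_, Nat.findGreatest_le N, ?_, ?_⟩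
  · exact Nat.le_findGreatest (P := P) hN hρ
  · exact Nat.findGreatest_spec (P := P) hN hρ
  · intro hlt
    have h := Nat.findGreatest_is_greatest (P := P) (Nat.lt_succ_self _) (Nat.succ_le_of_lt hlt)
    exact not_lt.mp h

/-- From `ρ < κ e^{−R(M)}` to an affine zero in the OPEN polydisc: some `(1 : z) ∈ V(𝔓)` with
`max |z_i − θ_i| < e^{−R(M)}` (`κ = 1/(4Θ²)`, `affine_near_of_projDist_le`).
[cite: Philippon1986Criteres, §3 p. 43] -/
theorem exists_affine_zero {𝔓 : Ideal (Rx 𝒮.m)}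
    (h𝔓c : ∀ g ∈ 𝔓, ∀ k : ℕ, homogeneousComponent k g ∈ 𝔓) (hne : (projZeros 𝔓).Nonempty)
    {ε : ℝ} (hε : ε ≤ 1) (hρ : rho 𝒮.ω 𝔓 < 𝒮.κ * ε) :
    ∃ z : Fin 𝒮.m → ℂ, (Fin.cons 1 z : Fin (𝒮.m + 1) → ℂ) ∈ projZeros 𝔓 ∧
      ∀ i, ‖z i - 𝒮.θ i‖ < ε := by
  obtain ⟨β, hβ, hd⟩ := exists_mem_projZeros_projDist_lt hne hρ
  have hκ := 𝒮.κ_pos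
  have hΘ := 𝒮.Θ_pos
  have hε0 : 0 < ε := by
    by_contra h
    push Not at h
    have : 𝒮.κ * ε ≤ 0 := mul_nonpos_of_nonneg_of_nonpos hκ.le h
    linarith [projDist_nonneg 𝒮.ω β]
  -- `projDist · Θ ≤ κ Θ ≤ 1/2`
  have hdΘ : projDist (Fin.cons 1 𝒮.θ) β * ‖(Fin.cons 1 𝒮.θ : Fin (𝒮.m + 1) → ℂ)‖ ≤ 1 / 2 := by
    change projDist 𝒮.ω β * 𝒮.Θ ≤ 1 / 2
    have h1 : projDist 𝒮.ω β * 𝒮.Θ ≤ 𝒮.κ * 𝒮.Θ := by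
      apply mul_le_mul_of_nonneg_right _ hΘ.le
      exact (hd.le.trans (mul_le_of_le_one_right hκ.le hε))
    have h2 : 𝒮.κ * 𝒮.Θ ≤ 1 / 2 := by
      unfold κ
      rw [div_mul_eq_mul_div, one_mul, div_le_iff₀ (by positivity)]
      nlinarith [𝒮.one_le_Θ]
    exact h1.trans h2
  obtain ⟨hβ0, -, hz⟩ := affine_near_of_projDist_le 𝒮.θ hβ.1 hdΘ
  refine ⟨fun j => β j.succ / β 0, cons_one_div_mem_projZeros h𝔓c hβ hβ0, fun i => ?_⟩
  calc ‖β i.succ / β 0 - 𝒮.θ i‖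
      ≤ 2 * ‖(Fin.cons 1 𝒮.θ : Fin (𝒮.m + 1) → ℂ)‖ ^ 2 * projDist (Fin.cons 1 𝒮.θ) β := hz i
    _ = 2 * 𝒮.Θ ^ 2 * projDist 𝒮.ω β := rfl
    _ < 2 * 𝒮.Θ ^ 2 * (𝒮.κ * ε) := by
        apply mul_lt_mul_of_pos_left hd (by positivity)
    _ = ε / 2 := by unfold κ; field_simp; ring
    _ < ε := by linarith

/-- **A generator outside `𝔓`** at the level `M` (Philippon 1986 p. 43): for `𝔓` homogeneous prime
of rank `r ≥ 2` with `V(𝔓) ≠ ∅` and `ρ_ω̄(𝔓) < κ e^{−R(M)}`, `N₀ ≤ M`, some `E M i ∉ 𝔓`.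
[cite: Philippon1986Criteres, §3 p. 43] -/
theorem exists_generator_not_mem {r : ℕ} (hr : 2 ≤ r) {𝔓 : Ideal (Rx 𝒮.m)} (h𝔓 : 𝔓.IsPrime)
    (h𝔓hom : 𝔓.IsHomogeneous (homogeneousSubmodule (Fin (𝒮.m + 1)) ℚ)) (h𝔓unm : IsUnmixedOfRank 𝔓 r)
    (hne : (projZeros 𝔓).Nonempty) {M : ℕ} (hM : 𝒮.N₀ ≤ M)
    (hρ : rho 𝒮.ω 𝔓 < 𝒮.κ * exp (-𝒮.R M)) : ∃ i, 𝒮.E M i ∉ 𝔓 := by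
  have h𝔓c : ∀ g ∈ 𝔓, ∀ k : ℕ, homogeneousComponent k g ∈ 𝔓 :=
    fun g hg k => homogeneousComponent_mem_of_mem h𝔓hom hg k
  obtain ⟨z, hz, hzθ⟩ := 𝒮.exists_affine_zero h𝔓c hne (exp_le_one_iff.mpr (by
    linarith [𝒮.one_le_R M])) hρ
  exact exists_not_mem_of_finite_zeros hr h𝔓 h𝔓hom h𝔓unm 𝒮.θ (𝒮.E M) (𝒮.finite_zeros M hM) hz hzθ
    (exp_pos _)

end Setup

end PhilipponMain

end Literature.NumberTheory.Transcendental

end
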